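import Summits.QuantumFields.YangMills.Theorems.SwapVirialDeficitQuantitativeLaplaceFibredTaylor
import Summits.QuantumFields.YangMills.Theorems.SwapVirialDeficitQuantitativeLaplaceFibredChartCubic
import HarnessLib

/-!
# Route `SwapVirialDeficit` (YangMills): quantitative Laplace method — the `1∕b` fibred chart law (odd∕even Taylor data) with the a.e. OFF-TUBE BOUND ON THE PRODUCT

Width seat `ym-line-sfw-p2-w2` g58 (cell ym-idea-1, free hands), `--supports stmt-QuantumFields-24197`.  Twin of ✓`laplaceMethod_quantitative_fibred_chart_cubic_offBound`
(§3 of `…FibredChartCubic`) for the `1∕b` core: ✓`laplaceMethod_quantitative_fibred_chart_of_taylor` with the pointwise `hout`∕`hΦ₀` replaced by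
`hoff : ∀ᵐ x ∂μ, x ∉ Ψ(M × B̄_R) → ‖e^{−β(f x−f₀)}·φ x‖ ≤ E_off` — needed when `M` is the BULK base only (tip valley points off the tube have `f = f₀`); the consumer
meets `hoff` by ✓`offTube_bound_of_cylinder`.

* ★★★ `laplaceMethod_quantitative_fibred_chart_of_taylor_offBound`.

HONEST FRAMING: generic; no model object appears; ⟨24197⟩ `SwapGluedStiffness`, ⟨24196⟩, ⟨22884⟩ stay OPEN; no stub ∕ crux ∕ rung ∕ summit is closed; the Yang–Mills mass gap is
NOT proved; no summit is proved by a line.  0 definitions, 0 `sorry`, standard axioms.  References: [cite: HasenpflugRudolfSprungk2024, App. 4.1 Thm 16], [cite: Breitung1994, Thm 41 p. 56].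
-/

set_option linter.style.longLine false
set_option linter.style.longFile 0
set_option linter.unusedSectionVars false

noncomputable section

open _root_.MeasureTheory _root_.Set _root_.Module _root_.Metric
open scoped _root_.Real _root_.InnerProductSpace

namespace Summit.QuantumFields.YangMills.Theorems.QuantitativeLaplace

variable {X : Type*} [MeasurableSpace X] {μ : Measure X} [IsFiniteMeasure μ]
variable {M : Type*} [MeasurableSpace M] {ν : Measure M} [SFinite ν]
variable {V : Type*} [NormedAddCommGroup V] [InnerProductSpace ℝ V] [FiniteDimensional ℝ V]
  [MeasurableSpace V] [BorelSpace V]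

/-- ★★★ **The `1∕b` fibred chart law with odd∕even Taylor data and the a.e. off-tube bound on the product.**  Hypotheses as
✓`laplaceMethod_quantitative_fibred_chart_of_taylor` except `hout`∕`hΦ₀nn`∕`hΦ₀` ↦ `hEoff : 0 ≤ E_off`, `hoff : ∀ᵐ x ∂μ, x ∉ Ψ(M × B̄_R) → ‖e^{−β(f x−f₀)}φ x‖ ≤ E_off`;
conclusion with the tail `E_off·μ(X)`. [cite: HasenpflugRudolfSprungk2024, App. 4.1 Thm 16] [cite: Breitung1994, Thm 41 p. 56] -/
theorem laplaceMethod_quantitative_fibred_chart_of_taylor_offBound {Ψ : M × V → X} {J : M × V → ℝ} {f φ : X → ℝ} {f₀ : ℝ}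
    {A : M → V →ₗ[ℝ] V} (hA : ∀ p, (A p).IsSymmetric) {lam : ℝ} (hlam : 0 < lam)
    (hcoer : ∀ p (y : V), lam * ‖y‖ ^ 2 ≤ ⟪A p y, y⟫_ℝ)
    (hAm : Measurable fun z : M × V => ⟪A z.1 z.2, z.2⟫_ℝ)
    {R B₃ B₄ N₁ N₂ β Eoff : ℝ} (hR : 0 < R) (hB₃ : 0 ≤ B₃) (hB₄ : 0 ≤ B₄) (hN₁ : 0 ≤ N₁) (hN₂ : 0 ≤ N₂) (hβ : 0 < β)
    (hsmall : (B₃ + B₄ * R) * R + B₄ * R ^ 2 ≤ lam / (8 * ((finrank ℝ V : ℝ) + 8)))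
    (hDR : (N₁ + N₂ * R) * R ≤ 1) (hGR : N₂ * R ^ 2 ≤ 1)
    (hΨ : Measurable Ψ) (hΨT : MeasurableSet (Ψ '' (univ ×ˢ closedBall (0 : V) R)))
    (hJm : Measurable J) (hJ0 : ∀ z ∈ (univ : Set M) ×ˢ closedBall (0 : V) R, 0 ≤ J z)
    (hchart : μ.restrict (Ψ '' (univ ×ˢ closedBall (0 : V) R)) =
      (((ν.prod volume).restrict (univ ×ˢ closedBall (0 : V) R)).withDensity fun z => ENNReal.ofReal (J z)).map Ψ)
    (hfm : Measurable f) (hφm : Measurable φ) {w₀ : M → ℝ}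
    (hw₀m : Measurable w₀) (hw₀ : ∀ p, 0 ≤ w₀ p) (hw₀i : Integrable w₀ ν)
    (hfT : ∀ p, ∃ τ : V → ℝ, (∀ y, τ (-y) = -τ y) ∧ (∀ y : V, ‖y‖ ≤ R → |τ y| ≤ B₃ * ‖y‖ ^ 3) ∧
      ∀ y : V, ‖y‖ ≤ R → |f (Ψ (p, y)) - f₀ - (1 / 2) * ⟪A p y, y⟫_ℝ - τ y| ≤ B₄ * ‖y‖ ^ 4)
    (hwT : ∀ p, ∃ lam' : V → ℝ, (∀ y, lam' (-y) = -lam' y) ∧ (∀ y : V, ‖y‖ ≤ R → |lam' y| ≤ N₁ * ‖y‖) ∧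
      ∀ y : V, ‖y‖ ≤ R → |J (p, y) * φ (Ψ (p, y)) - w₀ p * (1 + lam' y)| ≤ N₂ * w₀ p * ‖y‖ ^ 2)
    (hEoff : 0 ≤ Eoff)
    (hoff : ∀ᵐ x ∂μ, x ∉ Ψ '' (univ ×ˢ closedBall (0 : V) R) → ‖Real.exp (-(β * (f x - f₀))) * φ x‖ ≤ Eoff) :
    Integrable (fun x => Real.exp (-(β * (f x - f₀))) * φ x) μ ∧
    |(∫ x, Real.exp (-(β * (f x - f₀))) * φ x ∂μ) -
        (2 * π / β) ^ ((finrank ℝ V : ℝ) / 2) * ∫ p, w₀ p / Real.sqrt (LinearMap.det (A p)) ∂ν| ≤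
      (16 * ((finrank ℝ V : ℝ) + 8) / (lam * R ^ 2) + 16 * N₂ * ((finrank ℝ V : ℝ) + 8) / lam
        + 256 * (B₄ + ((B₃ + B₄ * R) + B₄ * R) * ((N₁ + N₂ * R) + N₂ * R)) * ((finrank ℝ V : ℝ) + 8) ^ 2 / lam ^ 2
        + 18432 * ((B₃ + B₄ * R) + B₄ * R) ^ 2 * ((finrank ℝ V : ℝ) + 8) ^ 3 / lam ^ 3) / β *
        ((2 * π / β) ^ ((finrank ℝ V : ℝ) / 2) * ∫ p, w₀ p / Real.sqrt (LinearMap.det (A p)) ∂ν) +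
      Eoff * μ.real univ := by
  set T : Set (M × V) := (univ : Set M) ×ˢ closedBall (0 : V) R with hTdef
  have hTm : MeasurableSet T := MeasurableSet.univ.prod measurableSet_closedBall
  set ft : M × V → ℝ := fun z => f (Ψ z) - f₀ with hft
  set wt : M × V → ℝ := fun z => J z * φ (Ψ z) with hwt
  have hftm : Measurable ft := (hfm.comp hΨ).sub measurable_const
  have hwtm : Measurable wt := hJm.mul (hφm.comp hΨ)
  have hfT' : ∀ p, ∃ τ : V → ℝ, (∀ y, τ (-y) = -τ y) ∧ (∀ y : V, ‖y‖ ≤ R → |τ y| ≤ B₃ * ‖y‖ ^ 3) ∧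
      ∀ y : V, ‖y‖ ≤ R → |ft (p, y) - (1 / 2) * ⟪A p y, y⟫_ℝ - τ y| ≤ B₄ * ‖y‖ ^ 4 := fun p => by
    obtain ⟨τ, h1, h2, h3⟩ := hfT p
    exact ⟨τ, h1, h2, fun y hy => by simpa only [hft] using h3 y hy⟩
  have hwT' : ∀ p, ∃ lam' : V → ℝ, (∀ y, lam' (-y) = -lam' y) ∧ (∀ y : V, ‖y‖ ≤ R → |lam' y| ≤ N₁ * ‖y‖) ∧
      ∀ y : V, ‖y‖ ≤ R → |wt (p, y) - w₀ p * (1 + lam' y)| ≤ N₂ * w₀ p * ‖y‖ ^ 2 := fun p => by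
    obtain ⟨l, h1, h2, h3⟩ := hwT p
    exact ⟨l, h1, h2, fun y hy => by simpa only [hwt] using h3 y hy⟩
  obtain ⟨hTint, -, hbd⟩ := laplaceMethod_quantitative_fibred_of_taylor (f := ft) (w := wt) hA hlam hcoer hAm hR hB₃ hB₄ hN₁ hN₂ hβ hsmall hDR hGR
    hftm hwtm hw₀m hw₀ hw₀i hfT' hwT'
  have hTint' : IntegrableOn (fun z => Real.exp (-(β * (f (Ψ z) - f₀))) * (J z * φ (Ψ z))) T (ν.prod volume) := hTint
  have hbd' : |(∫ z in T, Real.exp (-(β * (f (Ψ z) - f₀))) * (J z * φ (Ψ z)) ∂(ν.prod volume)) -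
      (2 * π / β) ^ ((finrank ℝ V : ℝ) / 2) * ∫ p, w₀ p / Real.sqrt (LinearMap.det (A p)) ∂ν| ≤ _ := hbd
  exact laplaceMethod_chart_of_tube_offBound (κ := ν.prod volume) hΨ hTm hΨT hJm hJ0 hchart hfm hφm hTint' hbd' hEoff hoff

end Summit.QuantumFields.YangMills.Theorems.QuantitativeLaplace

end
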